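import Mathlib
import Summits.CriticalPhenomena.SAWScalingLimit.Theorems.SAWRestrictionRigidityAxiomsOfLimitMarkovClockParam
import Summits.CriticalPhenomena.SAWScalingLimit.Theorems.SAWRestrictionRigidityAxiomsOfLimitMarkovPathKernel
import Summits.CriticalPhenomena.SAWScalingLimit.Theorems.SAWRestrictionRigidityAxiomsOfLimitMarkovSoftMarkov
import Literature.Probability.RandomPlanarGeometry.ChordalCurveFamilyProofs
import Literature.Probability.RandomPlanarGeometry.CurveClassStopAtMeasurable
import HarnessLib

/-!
# The soft-Markov theorem on curve classes, with an a.e. Borel reading of the kernel (AEM)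

Crux `AxiomsOfLimit` (stmt-CriticalPhenomena-1370), line `registered`, stub `stub_softMarkovAllF_aem`
(lead c5, wave 2). Theorems only.

This is the soft-Markov theorem `stub_softMarkovAllF` (lead c4, soft-Markov brick E2b) with ONE extra
conjunct. Every probability law `μ` on planar curve classes carried by simple curves inside a ball,
from `a` to `b ≠ a`, admits one map `Q : CurveClass ℂ → Measure (CurveClass ℂ)` with
`Q (trivial past) = μ`, the Markov disintegration
`μ (stopAt F ⁻¹' S ∩ startFrom F ⁻¹' T) = ∫⁻ γ in stopAt F ⁻¹' S, Q (γ.stopAt F) T ∂μ`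
for EVERY closed `F`, AND (new) for every closed `F` and Borel `T` a Borel `φ : CurveClass ℂ → ℝ≥0∞`
with `Q (γ.stopAt F) T = φ (γ.stopAt F)` for `μ`-a.e. `γ`: the kernel read at the past is almost
surely a MEASURABLE function of the past. This is what makes the a.e. restriction-kernel clause of the
crux independent of the version of the Markov kernel.

Proof: c4's transport of the path kernel `K` (`exists_pathKernel`) through the clock parametrisation
`Λ` (`SoftMarkov.exists_clockParam`) verbatim; the kernel is
`Q p := μ` at the trivial past, `dirac (const b)` at pasts ending at `b`, and
`(K (u p, Λ p)).map (future class)` otherwise. For the new conjunct at a closed `F ∌ a`: almost surely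
`K` agrees at `X_F (Λ γ) = (τ_F, (Λ γ)^{τ_F})` with the regular conditional distribution `κ_F`, a
genuine (measurable) Markov kernel, and `X_F (Λ γ)` is a Borel function of the past `γ.stopAt F`
because `Λ (γ.stopAt F) = (Λ γ)^{τ_F}` (locality of the clock) and the hitting parameter of the stopped
path is the hitting parameter (`hit_stp_hit`); so
`φ p := 1_{p.target = b} 1_T (const b) + 1_{p.target ≠ b} κ_F (τ_F (Λ p), Λ p) {future ∈ T}` serves.
For `F ∋ a` the past is a.s. trivial and `φ := μ T` serves.

References: G. F. Lawler, O. Schramm, W. Werner, Acta Math. 187 (2001), §2; O. Schramm, Israel J.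
Math. 118 (2000), §1 (domain Markov property); C. Dellacherie, P.-A. Meyer, *Probabilités et
potentiel* B, VI.43–45 (prediction at announceable times). All [folklore].
-/

noncomputable section

open MeasureTheory ProbabilityTheory Filter Topology Set Metric
open scoped ENNReal

namespace Summit.CriticalPhenomena.SAWScalingLimit.Theorems.AxiomsOfLimitKernelClause

open Literature.Probability.RandomPlanarGeometry
open Summit.CriticalPhenomena.SAWScalingLimit.Theorems.AxiomsOfLimitMarkov

/-- The path `ω` stopped at real time `t`: `u ↦ ω (min u (projIcc t))`. [folklore] -/
local notation3 "stp[" t ", " ω "]" =>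
  ContinuousMap.comp ω (ContinuousMap.id unitInterval ⊓
    ContinuousMap.const unitInterval (Set.projIcc (0:ℝ) 1 zero_le_one t))

/-- The hitting parameter of `F` by the path `ω`. [folklore] -/
local notation3 "hit[" F ", " ω "]" => Curve.hitParam F (Curve.mk ω)

/-- The pair (hitting parameter of `F`, path stopped there). [folklore] -/
local notation3 "XF[" F ", " ω "]" => (hit[F, ω], stp[hit[F, ω], ω])

/-- The class of the head of the path `ω` up to real time `r`. [folklore] -/
local notation3 "past[" r ", " ω "]" =>
  CurveClass.mk (Curve.mk (ContinuousMap.comp ω (Curve.affineClamp 0 r)))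

/-- The class of the tail of the path `ω` from real time `r` on. [folklore] -/
local notation3 "fut[" r ", " ω "]" =>
  CurveClass.mk (Curve.mk (ContinuousMap.comp ω (Curve.affineClamp r (1 - r))))

/-! ### The theorem -/

/-- **The soft-Markov theorem on curve classes with an a.e. Borel reading of the kernel (registered
stub `stub_softMarkovAllF_aem`).** Given the path-level theorem (hypothesis; the proof uses the
landed, stronger `exists_pathKernel`), every probability law on planar curve classes carried by
simple curves in `ball 0 R` from `a` to `b ≠ a` has ONE Markov kernel `Q` on classes, with
`Q (mk (const a)) = μ`, disintegrating `μ` along `(stopAt F, startFrom F)` for EVERY closed set `F`,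
and such that for every closed `F` and Borel `T` the function `γ ↦ Q (γ.stopAt F) T` agrees `μ`-a.e.
with a Borel function of the past `γ.stopAt F`. [folklore] -/
theorem stub_softMarkovAllF_aem : (∀ [MeasurableSpace C(unitInterval, ℂ)] [BorelSpace C(unitInterval, ℂ)] (μ : MeasureTheory.Measure C(unitInterval, ℂ)) [MeasureTheory.IsFiniteMeasure μ] (a : ℂ), Filter.Eventually (fun ω : C(unitInterval, ℂ) => ω 0 = a) (MeasureTheory.ae μ) → ∃ K : ℝ × C(unitInterval, ℂ) → MeasureTheory.Measure C(unitInterval, ℂ), ∀ F : Set ℂ, IsClosed F → a ∉ F → ∀ E : Set ((ℝ × C(unitInterval, ℂ)) × C(unitInterval, ℂ)), MeasurableSet E → μ {ω : C(unitInterval, ℂ) | ((((Literature.Probability.RandomPlanarGeometry.Curve.mk (ω)).hitParam F), ((ω).comp (ContinuousMap.id unitInterval ⊓ ContinuousMap.const unitInterval (Set.projIcc (0:ℝ) 1 zero_le_one (((Literature.Probability.RandomPlanarGeometry.Curve.mk (ω)).hitParam F)))))), ω) ∈ E} = MeasureTheory.lintegral μ (fun ω : C(unitInterval, ℂ) =>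 K (((Literature.Probability.RandomPlanarGeometry.Curve.mk (ω)).hitParam F), ((ω).comp (ContinuousMap.id unitInterval ⊓ ContinuousMap.const unitInterval (Set.projIcc (0:ℝ) 1 zero_le_one (((Literature.Probability.RandomPlanarGeometry.Curve.mk (ω)).hitParam F)))))) {y : C(unitInterval, ℂ) | ((((Literature.Probability.RandomPlanarGeometry.Curve.mk (ω)).hitParam F), ((ω).comp (ContinuousMap.id unitInterval ⊓ ContinuousMap.const unitInterval (Set.projIcc (0:ℝ) 1 zero_le_one (((Literature.Probability.RandomPlanarGeometry.Curve.mk (ω)).hitParam F)))))), y) ∈ E})) → ∀ (μ : MeasureTheory.Measure (Literature.Probability.RandomPlanarGeometry.CurveClass ℂ)) [MeasureTheory.IsProbabilityMeasure μ] (a b : ℂ) (R : ℝ), 0 < R → a ≠ b → Filter.Eventually (fun c : Literature.Probability.RandomPlanarGeometry.CurveClass ℂ => c ∈ Literature.Probability.RandomPlanarGeometry.CurveClass.simple ∧ c.range ⊆ Metric.ball (0:ℂ) R ∧ c.source = a ∧ c.target = b) (MeasureTheory.ae μ) → ∃ Q : Literature.Probability.RandomPlanarGeometry.CurveClass ℂ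 → MeasureTheory.Measure (Literature.Probability.RandomPlanarGeometry.CurveClass ℂ), Q (Literature.Probability.RandomPlanarGeometry.CurveClass.mk (Literature.Probability.RandomPlanarGeometry.Curve.const a)) = μ ∧ (∀ F : Set ℂ, IsClosed F → ∀ S T : Set (Literature.Probability.RandomPlanarGeometry.CurveClass ℂ), MeasurableSet S → MeasurableSet T → μ (Literature.Probability.RandomPlanarGeometry.CurveClass.stopAt F ⁻¹' S ∩ Literature.Probability.RandomPlanarGeometry.CurveClass.startFrom F ⁻¹' T) = MeasureTheory.lintegral (μ.restrict (Literature.Probability.RandomPlanarGeometry.CurveClass.stopAt F ⁻¹' S)) (fun γ => Q (γ.stopAt F) T)) ∧ (∀ F : Set ℂ, IsClosed F → ∀ T : Set (Literature.Probability.RandomPlanarGeometry.CurveClass ℂ), MeasurableSet T → ∃ φ : Literature.Probability.RandomPlanarGeometry.CurveClass ℂ → ENNReal, Measurable φ ∧ Filter.Eventually (fun γ : Literature.Probability.RandomPlanarGeometry.CurveClass ℂ => Q (γ.stopAt F) T = φ (γ.stopAt F)) (MeasureTheory.ae μ)) := by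
  intro _ μ _ a b R hR hab hae
  classical
  letI : MeasurableSpace C(unitInterval, ℂ) := borel _
  haveI : BorelSpace C(unitInterval, ℂ) := ⟨rfl⟩
  -- the clock parametrisation, the transported law on paths, the path kernel
  obtain ⟨u, Λ, hΛm, hrep, hloc⟩ := SoftMarkov.exists_clockParam hR
  have hgood : ∀ᵐ c ∂μ, (c ∈ CurveClass.simple ∧ c.range ⊆ ball (0:ℂ) R) ∧
      CurveClass.mk (Curve.mk (Λ c)) = c ∧ c.source = a ∧ c.target = b :=
    hae.mono fun c h => ⟨⟨h.1, h.2.1⟩, hrep c h.1 h.2.1, h.2.2⟩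
  have hν0 : ∀ᵐ ω ∂(μ.map Λ), ω 0 = a := by
    refine (ae_map_iff hΛm.aemeasurable
      ((continuous_eval_const (0 : unitInterval)).measurable (measurableSet_singleton a))).2
      (hgood.mono fun c h => ?_)
    obtain ⟨-, hmk, hsrc, -⟩ := h
    show (Curve.mk (Λ c)) 0 = a
    rw [← hsrc]
    exact congrArg CurveClass.source hmk
  have hmono : Monotone fun t : ℝ => MeasurableSpace.comap (fun ω : C(unitInterval, ℂ) => stp[t, ω])
      (inferInstance : MeasurableSpace C(unitInterval, ℂ)) := fun s t hst => by
    have h : (fun ω : C(unitInterval, ℂ) => stp[s, ω]) =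
        (fun ω : C(unitInterval, ℂ) => stp[s, ω]) ∘ fun ω : C(unitInterval, ℂ) => stp[t, ω] :=
      funext fun ω => (comp_stop_of_le (Set.monotone_projIcc zero_le_one hst) ω).symm
    show MeasurableSpace.comap (fun ω : C(unitInterval, ℂ) => stp[s, ω]) _ ≤ _
    rw [h, ← MeasurableSpace.comap_comp]
    exact MeasurableSpace.comap_mono (measurable_stop _).comap_le
  obtain ⟨K, hK⟩ := exists_pathKernel ⟨_, hmono, fun t => (measurable_stop _).comap_le⟩
    (fun _ => rfl) (μ.map Λ) hν0
  -- the Markov kernel on classes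
  obtain ⟨Q, hQa, hQb, hQK⟩ : ∃ Q : CurveClass ℂ → Measure (CurveClass ℂ),
      Q (CurveClass.mk (Curve.const a)) = μ ∧
      (∀ p, p ≠ CurveClass.mk (Curve.const a) → p.target = b →
        Q p = Measure.dirac (CurveClass.mk (Curve.const b))) ∧
      (∀ p, p ≠ CurveClass.mk (Curve.const a) → p.target ≠ b →
        Q p = (K (u p, Λ p)).map fun y => fut[u p, y]) :=
    ⟨fun p => if p = CurveClass.mk (Curve.const a) then μ else if p.target = b then
        Measure.dirac (CurveClass.mk (Curve.const b)) else (K (u p, Λ p)).map fun y => fut[u p, y],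
      if_pos rfl, fun p h1 h2 => by simp [h1, h2], fun p h1 h2 => by simp [h1, h2]⟩
  -- both clauses at a fixed closed set `F`
  have H : ∀ F : Set ℂ, IsClosed F →
      (∀ S T : Set (CurveClass ℂ), MeasurableSet S → MeasurableSet T →
        μ (CurveClass.stopAt F ⁻¹' S ∩ CurveClass.startFrom F ⁻¹' T) =
          ∫⁻ γ in CurveClass.stopAt F ⁻¹' S, Q (γ.stopAt F) T ∂μ) ∧
      ∀ T : Set (CurveClass ℂ), MeasurableSet T → ∃ φ : CurveClass ℂ → ℝ≥0∞, Measurable φ ∧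
        ∀ᵐ γ ∂μ, Q (γ.stopAt F) T = φ (γ.stopAt F) := by
    intro F hF
    have hSm : ∀ S : Set (CurveClass ℂ), MeasurableSet S →
        MeasurableSet (CurveClass.stopAt F ⁻¹' S) := fun S hS =>
      hS.preimage (CurveClass.measurable_stopAt hF)
    by_cases haF : a ∈ F
    · -- `a ∈ F`: the past is trivial and the future is the whole class
      have hAE : ∀ᵐ c ∂μ, c.stopAt F = CurveClass.mk (Curve.const a) ∧ c.startFrom F = c := by
        filter_upwards [hgood] with c h
        obtain ⟨-, hmk, hsrc, -⟩ := h
        have h0 : (Curve.mk (Λ c)) 0 = a := by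
          rw [← hsrc]
          exact congrArg CurveClass.source hmk
        obtain ⟨h1, h2⟩ := SoftMarkov.stopAt_mk_of_mem hF (Curve.mk (Λ c)) (by rw [h0]; exact haF)
        rw [← hmk, h1, h2, h0]
        exact ⟨rfl, rfl⟩
      refine ⟨fun S T hS hT => ?_, fun T _ => ⟨fun _ => μ T, measurable_const, hAE.mono fun c h => ?_⟩⟩
      · have h1 : μ (CurveClass.stopAt F ⁻¹' S ∩ CurveClass.startFrom F ⁻¹' T) =
            μ ({c | CurveClass.mk (Curve.const a) ∈ S} ∩ T) :=
          measure_congr (eventuallyEq_set.2 (hAE.mono fun c h => by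
            simp only [Set.mem_inter_iff, Set.mem_preimage, Set.mem_setOf_eq, h.1, h.2]))
        have h2 : ∫⁻ c in CurveClass.stopAt F ⁻¹' S, Q (c.stopAt F) T ∂μ =
            ∫⁻ _ in CurveClass.stopAt F ⁻¹' S, μ T ∂μ :=
          setLIntegral_congr_fun_ae (hSm S hS) (hAE.mono fun c h _ => by rw [h.1, hQa])
        have h3 : μ (CurveClass.stopAt F ⁻¹' S) = μ {c | CurveClass.mk (Curve.const a) ∈ S} :=
          measure_congr (eventuallyEq_set.2 (hAE.mono fun c h => by
            simp only [Set.mem_preimage, Set.mem_setOf_eq, h.1]))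
        rw [h1, h2, setLIntegral_const, h3]
        by_cases hSa : CurveClass.mk (Curve.const a) ∈ S
        · simp only [hSa, Set.setOf_true, Set.univ_inter, measure_univ, mul_one]
        · simp only [hSa, Set.setOf_false, Set.empty_inter, measure_empty, mul_zero]
      · show Q (c.stopAt F) T = μ T
        rw [h.1, hQa]
    · -- `a ∉ F`: transport of the path kernel
      have hτ : Measurable fun ω : C(unitInterval, ℂ) => hit[F, ω] := Curve.measurable_hitParam_mk hF
      have hX : Measurable fun ω : C(unitInterval, ℂ) => XF[F, ω] :=
        hτ.prodMk (measurable_stop_random hτ)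
      have hXid : Measurable fun ω : C(unitInterval, ℂ) => (XF[F, ω], id ω) := hX.prodMk measurable_id
      obtain ⟨hpc, hfc⟩ := SoftMarkov.continuous_past_fut
      have hPm : Measurable fun p : (ℝ × C(unitInterval, ℂ)) × C(unitInterval, ℂ) =>
          past[p.1.1, p.1.2] := hpc.measurable.comp measurable_fst
      have hFm : Measurable fun p : (ℝ × C(unitInterval, ℂ)) × C(unitInterval, ℂ) =>
          fut[p.1.1, p.2] := hfc.measurable.comp (measurable_fst.fst.prodMk measurable_snd)
      have hfutm : ∀ r : ℝ, Measurable fun y : C(unitInterval, ℂ) => fut[r, y] := fun r =>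
        hfc.measurable.comp (measurable_const.prodMk measurable_id)
      -- the conditional distribution of the path given (hitting time, stopped path)
      have hdis : ∀ s : Set ((ℝ × C(unitInterval, ℂ)) × C(unitInterval, ℂ)), MeasurableSet s →
          ∫⁻ ω, condDistrib id (fun ω : C(unitInterval, ℂ) => XF[F, ω]) (μ.map Λ) XF[F, ω]
              {y | (XF[F, ω], y) ∈ s} ∂(μ.map Λ) =
            (μ.map Λ) ((fun ω : C(unitInterval, ℂ) => (XF[F, ω], id ω)) ⁻¹' s) := by
        intro s hs
        have h1 := Measure.compProd_apply (μ := (μ.map Λ).map fun ω : C(unitInterval, ℂ) => XF[F, ω])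
          (κ := condDistrib id (fun ω : C(unitInterval, ℂ) => XF[F, ω]) (μ.map Λ)) hs
        rw [compProd_map_condDistrib aemeasurable_id, Measure.map_apply hXid hs,
          lintegral_map (Kernel.measurable_kernel_prodMk_left hs) hX] at h1
        exact h1.symm
      have hκK : ∀ᵐ c ∂μ, condDistrib id (fun ω : C(unitInterval, ℂ) => XF[F, ω]) (μ.map Λ)
          XF[F, Λ c] = K XF[F, Λ c] := ae_of_ae_map hΛm.aemeasurable (hK F hF haF)
      have hprob : ∀ x, IsProbabilityMeasure
          (condDistrib id (fun ω : C(unitInterval, ℂ) => XF[F, ω]) (μ.map Λ) x) := fun x =>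
        inferInstance
      have hmeasκ : ∀ s : Set ((ℝ × C(unitInterval, ℂ)) × C(unitInterval, ℂ)), MeasurableSet s →
          Measurable fun ω : C(unitInterval, ℂ) =>
            condDistrib id (fun ω : C(unitInterval, ℂ) => XF[F, ω]) (μ.map Λ) XF[F, ω]
              {y | (XF[F, ω], y) ∈ s} := fun s hs =>
        (Kernel.measurable_kernel_prodMk_left hs).comp hX
      -- (new) the kernel read at a Borel set of futures is a Borel function of the pair
      have hmeasT : ∀ T : Set (CurveClass ℂ), MeasurableSet T →
          Measurable fun x : ℝ × C(unitInterval, ℂ) =>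
            condDistrib id (fun ω : C(unitInterval, ℂ) => XF[F, ω]) (μ.map Λ) x
              {y | fut[x.1, y] ∈ T} := fun T hT =>
        Kernel.measurable_kernel_prodMk_left (hFm hT)
      generalize condDistrib id (fun ω : C(unitInterval, ℂ) => XF[F, ω]) (μ.map Λ) = κ
        at hdis hκK hprob hmeasκ hmeasT
      -- (k2): above a past ending at `b` the fibre sits on the trivial future
      have hk2 : ∀ᵐ ω ∂(μ.map Λ), (past[hit[F, ω], stp[hit[F, ω], ω]]).target = b →
          κ XF[F, ω] {y | fut[hit[F, ω], y] ≠ CurveClass.mk (Curve.const b)} = 0 := by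
        have hB : MeasurableSet {p : (ℝ × C(unitInterval, ℂ)) × C(unitInterval, ℂ) |
            (past[p.1.1, p.1.2]).target = b ∧ fut[p.1.1, p.2] ≠ CurveClass.mk (Curve.const b)} :=
          ((CurveClass.continuous_target.measurable.comp hPm) (measurableSet_singleton b)).inter
            (hFm (measurableSet_singleton _)).compl
        have h0 : ∫⁻ ω, κ XF[F, ω] {y | (XF[F, ω], y) ∈ {p : (ℝ × C(unitInterval, ℂ)) ×
            C(unitInterval, ℂ) | (past[p.1.1, p.1.2]).target = b ∧
              fut[p.1.1, p.2] ≠ CurveClass.mk (Curve.const b)}} ∂(μ.map Λ) = 0 := by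
          rw [hdis _ hB, Measure.map_apply hΛm (hXid hB)]
          refine measure_eq_zero_iff_ae_notMem.2 (hgood.mono fun c h hc => ?_)
          obtain ⟨⟨hcs, -⟩, hmk, -, htgt⟩ := h
          obtain ⟨h1, h2⟩ := SoftMarkov.stopAt_mk_mk hF (Λ c)
          rw [hmk] at h1 h2
          simp only [Set.mem_preimage, Set.mem_setOf_eq, id_eq] at hc
          refine hc.2 ?_
          rw [← h2, ← htgt]
          exact SoftMarkov.startFrom_eq_of_target_stopAt hF hcs (by rw [h1, hc.1, htgt])
        filter_upwards [(lintegral_eq_zero_iff (hmeasκ _ hB)).1 h0] with ω hω hb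
        rw [Pi.zero_apply] at hω
        rw [← hω]
        congr 1
        exact Set.ext fun y => by simp only [Set.mem_setOf_eq, hb, true_and]
      refine ⟨fun S T hS hT => ?_, fun T hT => ?_⟩
      · -- the Markov disintegration at `(F, S, T)`
        -- the common measurable integrand
        obtain ⟨M, hMdef⟩ : ∃ M : C(unitInterval, ℂ) → ℝ≥0∞, ∀ ω, M ω =
            if past[hit[F, ω], stp[hit[F, ω], ω]] ∈ S then
              (if (past[hit[F, ω], stp[hit[F, ω], ω]]).target = b then
                T.indicator 1 (CurveClass.mk (Curve.const b))
              else κ XF[F, ω] {y | fut[hit[F, ω], y] ∈ T}) else 0 := ⟨_, fun _ => rfl⟩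
        have hMm : Measurable M := by
          rw [funext hMdef]
          refine Measurable.ite (hS.preimage (hpc.measurable.comp hX))
            (Measurable.ite ?_ measurable_const (hmeasκ _ (hFm hT))) measurable_const
          exact (CurveClass.continuous_target.measurable.comp (hpc.measurable.comp hX))
            (measurableSet_singleton b)
        -- a.e. identifications on the class side
        have hAEμ : ∀ᵐ c ∂μ,
            (c ∈ CurveClass.stopAt F ⁻¹' S ∩ CurveClass.startFrom F ⁻¹' T ↔
              past[hit[F, Λ c], stp[hit[F, Λ c], Λ c]] ∈ S ∧ fut[hit[F, Λ c], Λ c] ∈ T) ∧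
            (CurveClass.stopAt F ⁻¹' S).indicator (fun c => Q (c.stopAt F) T) c = M (Λ c) := by
          filter_upwards [hgood, hκK] with c h hKc
          obtain ⟨⟨hcs, hcR⟩, hmk, -, htgt⟩ := h
          obtain ⟨h1, h2⟩ := SoftMarkov.stopAt_mk_mk hF (Λ c)
          rw [hmk] at h1 h2
          refine ⟨by simp only [Set.mem_inter_iff, Set.mem_preimage, h1, h2], ?_⟩
          rw [hMdef]
          by_cases hSc : c ∈ CurveClass.stopAt F ⁻¹' S
          · have hne : c.stopAt F ≠ CurveClass.mk (Curve.const a) := fun h =>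
              SoftMarkov.target_stopAt_ne hF haF (htgt.trans_ne hab.symm) (by rw [h]; rfl)
            rw [Set.indicator_of_mem hSc, ← h1, if_pos (Set.mem_preimage.1 hSc)]
            by_cases hb : (c.stopAt F).target = b
            · rw [if_pos hb, hQb _ hne hb, Measure.dirac_apply' _ hT]
            · obtain ⟨hΛp, hup⟩ := hloc c hcs hcR F hF
                (SoftMarkov.nonempty_of_target_stopAt_ne hF (by rwa [htgt]))
              rw [if_neg hb, hQK _ hne hb, hup, hΛp, Measure.map_apply (hfutm _) hT, ← hKc]
              rfl
          · rw [Set.indicator_of_notMem hSc, if_neg fun h => hSc (show c.stopAt F ∈ S by rwa [h1])]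
        -- a.e. identification on the path side
        have hAEν : ∀ᵐ ω ∂(μ.map Λ), κ XF[F, ω] {y | (XF[F, ω], y) ∈ {p : (ℝ × C(unitInterval, ℂ)) ×
            C(unitInterval, ℂ) | past[p.1.1, p.1.2] ∈ S ∧ fut[p.1.1, p.2] ∈ T}} = M ω := by
          filter_upwards [hk2] with ω hω
          rw [hMdef]
          by_cases hS' : past[hit[F, ω], stp[hit[F, ω], ω]] ∈ S
          · rw [if_pos hS', show {y | past[hit[F, ω], stp[hit[F, ω], ω]] ∈ S ∧ fut[hit[F, ω], y] ∈ T} =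
                {y | fut[hit[F, ω], y] ∈ T} from
              Set.ext fun y => by simp only [Set.mem_setOf_eq, hS', true_and]]
            by_cases hb : (past[hit[F, ω], stp[hit[F, ω], ω]]).target = b
            · rw [if_pos hb]
              haveI := hprob XF[F, ω]
              exact SoftMarkov.measure_setOf_mem_eq_indicator (hω hb) T
            · rw [if_neg hb]
          · rw [if_neg hS', show {y | past[hit[F, ω], stp[hit[F, ω], ω]] ∈ S ∧ fut[hit[F, ω], y] ∈ T} = ∅
              from Set.ext fun y => by
                simp only [Set.mem_setOf_eq, hS', false_and, Set.mem_empty_iff_false], measure_empty]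
        have hA : MeasurableSet {p : (ℝ × C(unitInterval, ℂ)) × C(unitInterval, ℂ) |
            past[p.1.1, p.1.2] ∈ S ∧ fut[p.1.1, p.2] ∈ T} := (hPm hS).inter (hFm hT)
        calc μ (CurveClass.stopAt F ⁻¹' S ∩ CurveClass.startFrom F ⁻¹' T)
            = μ (Λ ⁻¹' {ω | (XF[F, ω], ω) ∈ {p : (ℝ × C(unitInterval, ℂ)) × C(unitInterval, ℂ) |
                past[p.1.1, p.1.2] ∈ S ∧ fut[p.1.1, p.2] ∈ T}}) :=
              measure_congr (eventuallyEq_set.2 (hAEμ.mono fun c h => h.1))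
          _ = ∫⁻ ω, κ XF[F, ω] {y | (XF[F, ω], y) ∈ {p : (ℝ × C(unitInterval, ℂ)) × C(unitInterval, ℂ) |
                past[p.1.1, p.1.2] ∈ S ∧ fut[p.1.1, p.2] ∈ T}} ∂(μ.map Λ) := by
              rw [hdis _ hA, Measure.map_apply hΛm (hXid hA)]
              rfl
          _ = ∫⁻ ω, M ω ∂(μ.map Λ) := lintegral_congr_ae hAEν
          _ = ∫⁻ c, M (Λ c) ∂μ := lintegral_map hMm hΛm
          _ = ∫⁻ c, (CurveClass.stopAt F ⁻¹' S).indicator (fun c => Q (c.stopAt F) T) c ∂μ :=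
              lintegral_congr_ae (hAEμ.mono fun c h => h.2.symm)
          _ = _ := lintegral_indicator (hSm S hS) _
      · -- (new) the kernel read at the past is a.e. a Borel function of the past
        refine ⟨fun p => if p.target = b then T.indicator 1 (CurveClass.mk (Curve.const b))
            else κ (hit[F, Λ p], Λ p) {y | fut[hit[F, Λ p], y] ∈ T}, ?_, ?_⟩
        · exact Measurable.ite (CurveClass.continuous_target.measurable (measurableSet_singleton b))
            measurable_const ((hmeasT T hT).comp ((hτ.comp hΛm).prodMk hΛm))
        · filter_upwards [hgood, hκK] with c h hKc
          obtain ⟨⟨hcs, hcR⟩, -, -, htgt⟩ := h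
          have hne : c.stopAt F ≠ CurveClass.mk (Curve.const a) := fun h =>
            SoftMarkov.target_stopAt_ne hF haF (htgt.trans_ne hab.symm) (by rw [h]; rfl)
          show Q (c.stopAt F) T = if (c.stopAt F).target = b then
              T.indicator 1 (CurveClass.mk (Curve.const b))
            else κ (hit[F, Λ (c.stopAt F)], Λ (c.stopAt F)) {y | fut[hit[F, Λ (c.stopAt F)], y] ∈ T}
          by_cases hb : (c.stopAt F).target = b
          · rw [if_pos hb, hQb _ hne hb, Measure.dirac_apply' _ hT]
          · obtain ⟨hΛp, hup⟩ := hloc c hcs hcR F hF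
              (SoftMarkov.nonempty_of_target_stopAt_ne hF (by rwa [htgt]))
            rw [if_neg hb, hQK _ hne hb, hup, hΛp, Measure.map_apply (hfutm _) hT, ← hKc,
              hit_stp_hit hF Subset.rfl (Λ c)]
            rfl
  exact ⟨Q, hQa, fun F hF => (H F hF).1, fun F hF => (H F hF).2⟩

end Summit.CriticalPhenomena.SAWScalingLimit.Theorems.AxiomsOfLimitKernelClause

end
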